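import Mathlib.LinearAlgebra.Quotient.Basic
import Mathlib.LinearAlgebra.Isomorphisms
import Mathlib.Algebra.Module.Submodule.Ker
import Mathlib.Algebra.Module.Submodule.Range
import Mathlib.Algebra.Module.Submodule.Pointwise
import Mathlib.Tactic.Module
import Mathlib.Tactic.Abel
import HarnessLib

/-!
# The degree-`n` index identity `P/(u^*B ⊕ ker u_*) ≅ B/nB` and the dichotomy "Ihara defect or fusion" (cell `b2b-bsdres`, seat additive-p4 gen 42, memo V74 §2 — K125)

HONEST FRAMING (verbatim, cell `b2b-bsdres`): the goal of the cell is to DELETE the COMBINATION-SHAPED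
residual classes for ALL analytic-rank `≤ 1` curves over `ℚ` — "full BSD formula for every rank `≤ 1`
curve in class `C`" assembled STRICTLY from published theorems — so that the rank-`≤ 1` remainder
becomes exactly the CONSTRUCTION-SHAPED classes, which are TYPED (missing-input Props), NOT attempted;
this is not "finishing BSD". This file: TOOL theorems (pure module algebra; 0 defs, 0 facts, nothing
booked; X4 stays CONSTRUCTION-shaped; no mark moves).

## Why

Prop. V64-D of the θ-rows' END STATE (THETA-ROWS-ENDSTATE §2 (b)) consumes the quaternionic
multiplicity-one input (MO^θ) for the SYNTHEME MODULE `S₀(L) = ker(u_* : X_perm(L) → X(L))`, where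
`X_perm(L)` is the degree-0 divisor group on supersingular points (char `ℓ₂`, Eichler level `L`)
equipped with a syntheme (= `X⁺_ns(3)`-structure) on the 3-torsion, `X(L)` the plain one, `u_*` forgets
the syntheme and `u^*` pulls back, `u_* ∘ u^* = 3 = deg u` (memo V64 §4.3; memo V74 §2; instrument E17b
measured `S₀`). Memo V74 §2 records that at `p = 3` the syntheme cover has degree `p`, so the
decomposition "`X_perm = u^*X ⊕ S₀`" holds over `ℚ` but FAILS integrally exactly at `3`, with defect
`X/3X`, and that consequently at every maximal ideal of residue characteristic `3` in the support of `X`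
EITHER the Ihara-type statement for the syntheme cover fails OR the ns-old and θ-new parts fuse. This
file is the abstract algebra behind those two sentences, for any commutative ring `R`, modules `P`
(for `X_perm`), `B` (for `X`), maps `us : P → B` (for `u_*`), `up : B → P` (for `u^*`) and scalar `n`
with `us (up b) = n • b`:

* `mem_range_sup_ker_iff_of_comp_eq_smul` — `x ∈ range up ⊔ ker us ↔ ∃ b, us x = n • b`
  (no surjectivity, no torsion hypothesis);
* `range_inf_ker_eq_bot_of_comp_eq_smul` — `range up ⊓ ker us = ⊥` when `n` is a non-zero-divisor
  on `B` (the sum `u^*X + S₀` is direct);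
* `ker_mkQ_comp_eq_range_sup_ker` — the kernel of `P → B → B/nB` is `range up ⊔ ker us`;
* `nonempty_quotient_range_sup_ker_equiv` — **THE DEGREE-`n` INDEX IDENTITY**: for `us` surjective,
  `P ⧸ (range up ⊔ ker us) ≃ₗ[R] B ⧸ n•B` (memo V74 §2 (i): `X_perm/(u^*X ⊕ S₀) ≅ X/3X`);
* `comap_smul_inf_range_sup_ker_eq` — with `Sat := (range up).comap (n • id) = {x | n • x ∈ range up}` (the one-step
  `n`-saturation of `u^*B`; `Sat/range up` = the IHARA DEFECT `I₁` of the cover), if `n` is a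
  non-zero-divisor on `B` and on `ker us` then `Sat ⊓ (range up ⊔ ker us) = range up` — i.e.
  `I₁ = Sat/range up` injects into `P/(range up ⊔ ker us) ≅ B/nB`, with cokernel `P/(Sat ⊔ ker us)`
  (the FUSION MODULE `I₂`): the exact sequence `0 → I₁ → B/nB → I₂ → 0` of memo V74 §2 (i);
* `smul_top_eq_top_of_no_defect_of_no_fusion` / `ihara_defect_or_fusion` — **THE DICHOTOMY**: if there is
  no Ihara defect (`Sat ≤ range up`) and no fusion (`Sat ⊔ ker us = ⊤`) then `n • B = B`; so
  `n • B ≠ B` forces an Ihara defect or a fusion (memo V74 §2 (i)–(ii): at `𝔪 ∈ Supp X` of residue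
  characteristic `3`, localisation being exact, one of the two is non-trivial).

No number theory enters; which lattices `P`, `B` and which `n` an application uses is displayed there.

## References (context only; the proofs are elementary)

* K. A. Ribet, Invent. Math. 100 (1990) 431–476, §3 (degeneracy maps on character groups; the
  pattern `Y = ker δ`, Thms 3.19–3.20). [cite: Ribet1990, §3]
* D. Kohen, A. Pacetti, «Heegner points on Cartan non-split curves», Thm 2.1 (the `X_ns`-model of the
  `N²`-new part, after Chen and Edixhoven) — context for the application only.
-/

namespace Summit.BirchSwinnertonDyer.Rank1Residual.LevelLowering

open Pointwise

section DegreeIndex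

variable {R P B : Type*} [CommRing R] [AddCommGroup P] [Module R P] [AddCommGroup B] [Module R B]

/-- `x ∈ range up ⊔ ker us ↔ us x ∈ n•B` when `us ∘ up = n`. No surjectivity, no torsion hypothesis. -/
theorem mem_range_sup_ker_iff_of_comp_eq_smul (us : P →ₗ[R] B) (up : B →ₗ[R] P) (n : R)
    (h : ∀ b, us (up b) = n • b) (x : P) :
    x ∈ LinearMap.range up ⊔ LinearMap.ker us ↔ ∃ b : B, us x = n • b := by
  constructor
  · intro hx
    obtain ⟨y, hy, s, hs, rfl⟩ := Submodule.mem_sup.mp hx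
    obtain ⟨b, rfl⟩ := LinearMap.mem_range.mp hy
    refine ⟨b, ?_⟩
    rw [map_add, h, LinearMap.mem_ker.mp hs, add_zero]
  · rintro ⟨b, hb⟩
    refine Submodule.mem_sup.mpr ⟨up b, LinearMap.mem_range_self up b, x - up b, ?_, add_sub_cancel _ _⟩
    rw [LinearMap.mem_ker, map_sub, hb, h, sub_self]

/-- The sum `u^*B + ker u_*` is DIRECT when `n` is a non-zero-divisor on `B`. -/
theorem range_inf_ker_eq_bot_of_comp_eq_smul (us : P →ₗ[R] B) (up : B →ₗ[R] P) (n : R)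
    (h : ∀ b, us (up b) = n • b) (hnB : ∀ b : B, n • b = 0 → b = 0) :
    LinearMap.range up ⊓ LinearMap.ker us = ⊥ := by
  rw [eq_bot_iff]
  rintro x ⟨hx, hx'⟩
  obtain ⟨b, rfl⟩ := LinearMap.mem_range.mp hx
  have hb : n • b = 0 := by rw [← h]; exact LinearMap.mem_ker.mp hx'
  rw [Submodule.mem_bot, hnB b hb, map_zero]

/-- The kernel of `P → B → B ⧸ n•B` is `range up ⊔ ker us`. -/
theorem ker_mkQ_comp_eq_range_sup_ker (us : P →ₗ[R] B) (up : B →ₗ[R] P) (n : R)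
    (h : ∀ b, us (up b) = n • b) :
    LinearMap.ker ((n • (⊤ : Submodule R B)).mkQ ∘ₗ us) = LinearMap.range up ⊔ LinearMap.ker us := by
  ext x
  rw [LinearMap.mem_ker, LinearMap.comp_apply, Submodule.mkQ_apply, Submodule.Quotient.mk_eq_zero,
    mem_range_sup_ker_iff_of_comp_eq_smul us up n h, Submodule.mem_smul_pointwise_iff_exists]
  constructor
  · rintro ⟨b, -, hb⟩
    exact ⟨b, hb.symm⟩
  · rintro ⟨b, hb⟩
    exact ⟨b, Submodule.mem_top, hb.symm⟩

/-- **THE DEGREE-`n` INDEX IDENTITY** (memo V74 §2 (i): `X_perm/(u^*X ⊕ S₀) ≅ X/3X`): for `us`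
surjective with `us ∘ up = n`, `P ⧸ (range up ⊔ ker us) ≃ B ⧸ n•B`, induced by `us`.
[cite: Ribet1990, §3] -/
theorem nonempty_quotient_range_sup_ker_equiv (us : P →ₗ[R] B) (up : B →ₗ[R] P) (n : R)
    (h : ∀ b, us (up b) = n • b) (hsurj : Function.Surjective us) :
    Nonempty ((P ⧸ (LinearMap.range up ⊔ LinearMap.ker us)) ≃ₗ[R]
      (B ⧸ (n • (⊤ : Submodule R B)))) := by
  have hs : Function.Surjective ((n • (⊤ : Submodule R B)).mkQ ∘ₗ us) :=
    (Submodule.mkQ_surjective _).comp hsurj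
  exact ⟨(Submodule.quotEquivOfEq _ _ (ker_mkQ_comp_eq_range_sup_ker us up n h).symm).trans
    (LinearMap.quotKerEquivOfSurjective _ hs)⟩

/-- **`I₁ ↪ B/nB`**: with `Sat = {x | n • x ∈ range up}` (one-step `n`-saturation of `u^*B`), if `n`
is a non-zero-divisor on `B` and on `ker us`, then `Sat ⊓ (range up ⊔ ker us) = range up` — the
Ihara defect `Sat/range up` injects into `P/(range up ⊔ ker us) ≅ B/nB`, with cokernel the fusion module
`P/(Sat ⊔ ker us)`. [cite: Ribet1990, §3] -/
theorem comap_smul_inf_range_sup_ker_eq (us : P →ₗ[R] B) (up : B →ₗ[R] P) (n : R)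
    (h : ∀ b, us (up b) = n • b) (hnB : ∀ b : B, n • b = 0 → b = 0)
    (hnK : ∀ s ∈ LinearMap.ker us, n • s = 0 → s = 0) :
    (LinearMap.range up).comap (n • (LinearMap.id : P →ₗ[R] P)) ⊓
        (LinearMap.range up ⊔ LinearMap.ker us) = LinearMap.range up := by
  apply le_antisymm
  · intro x hxx
    obtain ⟨hx, hx'⟩ := Submodule.mem_inf.mp hxx
    rw [Submodule.mem_comap, LinearMap.smul_apply, LinearMap.id_apply] at hx
    obtain ⟨y, hy, s, hs, rfl⟩ := Submodule.mem_sup.mp hx'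
    obtain ⟨b, rfl⟩ := LinearMap.mem_range.mp hy
    obtain ⟨b', hb'⟩ := LinearMap.mem_range.mp hx
    -- `n • s = up (b' - n • b) ∈ range up ⊓ ker us = ⊥`
    have hns : n • s ∈ LinearMap.range up ⊓ LinearMap.ker us := by
      refine ⟨LinearMap.mem_range.mpr ⟨b' - n • b, ?_⟩, (LinearMap.ker us).smul_mem n hs⟩
      rw [map_sub, map_smul, hb', smul_add]
      abel
    rw [range_inf_ker_eq_bot_of_comp_eq_smul us up n h hnB, Submodule.mem_bot] at hns
    rw [hnK s hs hns, add_zero]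
    exact LinearMap.mem_range_self up b
  · intro x hx
    refine Submodule.mem_inf.mpr ⟨?_, Submodule.mem_sup_left hx⟩
    obtain ⟨b, rfl⟩ := LinearMap.mem_range.mp hx
    rw [Submodule.mem_comap, LinearMap.smul_apply, LinearMap.id_apply, ← map_smul]
    exact LinearMap.mem_range_self up (n • b)

/-- **No Ihara defect and no fusion force `n • B = B`.** If `Sat ≤ range up` (`I₁ = 0`) and
`Sat ⊔ ker us = ⊤` (`I₂ = 0`) then every `b ∈ B` is divisible by `n` (for `us` surjective). -/
theorem smul_top_eq_top_of_no_defect_of_no_fusion (us : P →ₗ[R] B) (up : B →ₗ[R] P) (n : R)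
    (h : ∀ b, us (up b) = n • b) (hsurj : Function.Surjective us)
    (hI₁ : (LinearMap.range up).comap (n • (LinearMap.id : P →ₗ[R] P)) ≤ LinearMap.range up)
    (hI₂ : (LinearMap.range up).comap (n • (LinearMap.id : P →ₗ[R] P)) ⊔ LinearMap.ker us = ⊤) :
    n • (⊤ : Submodule R B) = ⊤ := by
  have htop : LinearMap.range up ⊔ LinearMap.ker us = ⊤ :=
    top_le_iff.mp (hI₂ ▸ sup_le_sup_right hI₁ _)
  refine top_le_iff.mp fun b _ => ?_
  obtain ⟨x, rfl⟩ := hsurj b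
  have hx : x ∈ LinearMap.range up ⊔ LinearMap.ker us := htop ▸ Submodule.mem_top
  obtain ⟨b', hb'⟩ := (mem_range_sup_ker_iff_of_comp_eq_smul us up n h x).mp hx
  rw [hb']
  exact Submodule.smul_mem_pointwise_smul b' n ⊤ Submodule.mem_top

/-- **THE DICHOTOMY** (memo V74 §2 (i)–(ii)): if `B ≠ n • B` then EITHER the `n`-saturation of `u^*B`
is strictly bigger than `u^*B` (an Ihara defect) OR `Sat + ker us ≠ P` (the old and new parts fuse).
[cite: Ribet1990, §3] -/
theorem ihara_defect_or_fusion (us : P →ₗ[R] B) (up : B →ₗ[R] P) (n : R)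
    (h : ∀ b, us (up b) = n • b) (hsurj : Function.Surjective us)
    (hB : n • (⊤ : Submodule R B) ≠ ⊤) :
    ¬ ((LinearMap.range up).comap (n • (LinearMap.id : P →ₗ[R] P)) ≤ LinearMap.range up) ∨
      (LinearMap.range up).comap (n • (LinearMap.id : P →ₗ[R] P)) ⊔ LinearMap.ker us ≠ ⊤ := by
  rw [or_iff_not_imp_left, not_not]
  intro hI₁ hI₂
  exact hB (smul_top_eq_top_of_no_defect_of_no_fusion us up n h hsurj hI₁ hI₂)

end DegreeIndex

end Summit.BirchSwinnertonDyer.Rank1Residual.LevelLowering
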